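import Summits.QuantumFields.BalabanUV.Beta.CapRowsTail
import Summits.QuantumFields.BalabanUV.Beta.GAN24.CombesThomas

/-!
# Beta / GAN24 / MonotoneCauchy — the LIMIT-FREE form of the monotonicity route (gan24-p4): a CAUCHY band anchored at the last certified row
# BINDER-OWNERS row G-an2-4 ∕ (CONV-C), ALTERNATIVE DISCHARGE «rate OR monotonicity»; NOT IN PRINT — our proof attempt

HONEST FRAMING (page 1 of everything the β sub-cell writes): discharging `BetaPertH` makes Bałaban's UV stability UNCONDITIONAL — a
real constructive-QFT result; it is NOT the continuum limit and NOT the Clay problem.  HONEST DEPENDENCY (cell reorg 2026-08-19, verbatim):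
«continuum YM on T⁴ ⇐ BetaPertH ∧ nine spine estimates (0/9 proved); BetaPertH ⇐ (D1) ∧ (D4) ∧ CAP+tail; G-an2-4 gates asym, D1 and NE2/3/4.»
HONEST LABEL: «not in print; our proof attempt; alternative discharge of the G-an2-4 row (rate OR monotonicity)»; 0 binders instantiated.

ABSOLUTE RULE (cell charter, verbatim): "No internally-minted statement may enter as a cited fact. Every hypothesis is either
kernel-proved in this package or a verbatim quotation of a PUBLISHED theorem with page reference. The manuscript(s) under audit are
NOT citable for their own disputed steps — they are the thing under adjudication; programme-internal (2001/route/tribunal) claims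
are never citable."  Nothing is cited; [folklore] throughout.

## WHAT THIS SIBLING OF `GAN24/Monotone` ADDS.  The band of `GAN24/Monotone` is centred at the LIMIT value `binf` and its end-to-end theorem
needs the limit kernels `(A∞, V∞, W∞)` and row D1's identification `secondMoment (hessKer A∞ V∞ W∞) μ ν = binf`.  For the FLOOR that row CAP-k's
certified road consumes, NO LIMIT IS NEEDED: an eventual CAUCHY band `|b j − b j'| ≤ E` (`j, j' ≥ k₀`) anchored at the last certified row gives
`min m₀ (m − E) ≤ b k` for every `k` (`m = lo k₀`, `m₀ = min lo`, an5's `Rows.m ∕ Rows.m₀`) — the same shape as an5's certified-road constant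
`min m₀ (3(m − c₀θ^{k₀})/4)` with the RATE term replaced by the band.  Consequently the monotone route closes the tail from

  certified rows (k ≤ k₀)  +  (MONO-K)₂ `SupCauchyBand A η₀ k₀` (pairwise sup-deviations of the resolvent slot beyond `k₀` bounded by ONE datum `η₀`;
  for Loewner-ordered fibre matrices `η₀ = tr P_{k₀} − (uniform trace floor)`, sibling `GAN24/MonotoneLoewner`)  +  (I3) uniform decay  +  (DEV-SW) pairwise jet deviations,

with NO rate, NO limit object and NO limit identification (`betaAvgAFH_of_rows_supCauchyBand`, §5).  The value `binf = stepBal N Lc` (row D1) is then needed only for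
the continuum reading of the floor, not for `inf_k β_k > 0`.
-/

namespace Summit.QuantumFields.BalabanUV.Beta.GAN24.MonotoneCauchy

open Filter Topology
open Literature.MathematicalPhysics.QuantumFieldTheory.Balaban1983to89
open Literature.MathematicalPhysics.QuantumFieldTheory.Balaban1983to89.Beta
open FlowStep
open B12Sec2to5 (betaPrime510)
open B12Beta (secondMoment)
open ExpKernelCalculus (Site MKer Decays VertexFamily VertexFamily₂ hessKer)
open HessKerRate (lipConst decays_sub geomRate_secondMoment_hessKer)
open Beta.RemainderChain (RemainderConst)
open Beta.AveragedAFCarrier (BetaAvgAFH betaAvgAFH_of_betaLowerH)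
open Beta.RemainderConstCertified (betaLowerH_of_floor_const)
open Summit.QuantumFields.BalabanUV.Beta.CapRows
open Summit.QuantumFields.BalabanUV.Beta.CapRowsTail
open Summit.QuantumFields.BalabanUV.Beta.GAN24.CombesThomas (SupBound decays_half_of_decays_supBound decays_of_le_rate)

/-! ## §1 The Cauchy band -/

section Shapes

variable {b : ℕ → ℝ}

/-- SOCKET (B₂): an EVENTUAL CAUCHY BAND — `∀ j j' ≥ k₀, |b j − b j'| ≤ E`.  No limit value enters.  A binder shape; nothing asserted. [folklore] -/
def EventualCauchyBand (b : ℕ → ℝ) (E : ℝ) (k₀ : ℕ) : Prop := ∀ j j', k₀ ≤ j → k₀ ≤ j' → |b j - b j'| ≤ E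

/-- Widening ∕ later start. [folklore] -/
theorem EventualCauchyBand.mono {E E' : ℝ} {k₀ k₁ : ℕ} (h : EventualCauchyBand b E k₀) (hE : E ≤ E') (hk : k₀ ≤ k₁) :
    EventualCauchyBand b E' k₁ := fun j j' hj hj' => (h j j' (hk.trans hj) (hk.trans hj')).trans hE

/-- Nonnegativity of the width. [folklore] -/
theorem EventualCauchyBand.nonneg {E : ℝ} {k₀ : ℕ} (h : EventualCauchyBand b E k₀) : 0 ≤ E :=
  (abs_nonneg _).trans (h k₀ k₀ le_rfl le_rfl)

/-- A band of half-width `E` around ANY centre `x` from `k₀` gives the Cauchy band of width `2E`. [folklore] -/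
theorem eventualCauchyBand_of_centred {x E : ℝ} {k₀ : ℕ} (h : ∀ k, k₀ ≤ k → |b k - x| ≤ E) : EventualCauchyBand b (2 * E) k₀ := by
  intro j j' hj hj'
  have h1 := abs_le.mp (h j hj)
  have h2 := abs_le.mp (h j' hj')
  rw [abs_le]
  constructor <;> linarith [h1.1, h1.2, h2.1, h2.2]

/-- Conversely a Cauchy band of width `E` and a limit `binf` give the centred band of half-width `E` (closedness of `≤`). [folklore] -/
theorem centred_of_eventualCauchyBand {E binf : ℝ} {k₀ : ℕ} (h : EventualCauchyBand b E k₀) (hlim : Tendsto b atTop (𝓝 binf)) :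
    ∀ k, k₀ ≤ k → |b k - binf| ≤ E := by
  intro k hk
  have hc : Tendsto (fun j' => |b k - b j'|) atTop (𝓝 |b k - binf|) := (tendsto_const_nhds.sub hlim).abs
  exact le_of_tendsto hc (Filter.eventually_atTop.mpr ⟨k₀, fun j' hj' => h k j' hk hj'⟩)

/-- (C) contraction at ratio `θ ≤ 1` with ONE datum `|b k₀ − binf| ≤ D` ⟹ Cauchy band `2D` (through the centred band). [folklore] -/
theorem eventualCauchyBand_of_contractingTail {binf θ D : ℝ} {k₀ : ℕ} (h : ContractingTail b binf θ k₀) (hθ0 : 0 ≤ θ)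
    (hθ1 : θ ≤ 1) (hD : |b k₀ - binf| ≤ D) : EventualCauchyBand b (2 * D) k₀ := by
  refine eventualCauchyBand_of_centred (x := binf) fun k hk => ?_
  calc |b k - binf| ≤ θ ^ (k - k₀) * |b k₀ - binf| := abs_sub_le_of_contractingTail h hθ0 k hk
    _ ≤ 1 * D := mul_le_mul (pow_le_one₀ hθ0 hθ1) hD (abs_nonneg _) zero_le_one
    _ = D := one_mul D

end Shapes

/-! ## §2 ROWS × CAUCHY BAND: the floor anchored at the last certified row, and the (R15) carrier -/

section RowsBand

variable {b : ℕ → ℝ}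

/-- **ROWS × (B₂)**: certified rows up to `k₀` and a Cauchy band from some `kb ≤ k₀` (so that the anchor row `k₀` lies in the band) ⟹
`min m₀ (m − E) ≤ b k` for EVERY `k` (`m = lo k₀`, `m₀ = min_{k ≤ k₀} lo k`).  No limit value. [folklore] -/
theorem floor_of_rows_eventualCauchyBand (c : Rows b) {E : ℝ} {kb : ℕ} (h : EventualCauchyBand b E kb) (hkb : kb ≤ c.k₀) :
    ∀ k, min ((c.m₀ : ℚ) : ℝ) ((c.m : ℚ) - E) ≤ b k := by
  intro k
  rcases lt_or_ge k (c.k₀ + 1) with hk | hk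
  · exact (min_le_left _ _).trans (c.hsmall k hk)
  · have h1 := (abs_le.mp (h c.k₀ k hkb (hkb.trans (Nat.le_of_succ_le hk)))).2
    have h2 := c.hcert
    exact (min_le_right _ _).trans (by linarith)

variable {β : HBeta}

/-- **END (B₂)**: `OneLoopSplit S`, rows `c : CapRows.Rows S.β0` (LITERALLY beta-an5's carrier), a Cauchy band from `kb ≤ k₀`, constant remainder ⟹
`BetaAvgAFH (min m₀ (m − E) − r) 0 γ₀ β` — compare an5's `betaAvgAFH_of_capRows` (constant `min m₀ (3(m − c₀θ^{k₀})/4) − r`): the rate term is replaced by the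
band width, and no `GeomRate`, `binf`, `hk₂` is asked. [folklore] -/
theorem betaAvgAFH_of_rows_eventualCauchyBand (S : B12Beta.OneLoopSplit β) (c : Rows S.β0) {E : ℝ} {kb : ℕ}
    (h : EventualCauchyBand S.β0 E kb) (hkb : kb ≤ c.k₀) {γ₀ r : ℝ} (hrem : RemainderConst S γ₀ r) :
    BetaAvgAFH (min ((c.m₀ : ℚ) : ℝ) ((c.m : ℚ) - E) - r) 0 γ₀ β :=
  betaAvgAFH_of_betaLowerH (betaLowerH_of_floor_const S (floor_of_rows_eventualCauchyBand c h hkb) hrem)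

end RowsBand

/-! ## §3 THE CAUCHY BAND FROM THE KERNEL CALCULUS: pairwise eventual deviations of the ingredients (no limit kernels) -/

section KernelBand

variable {D : ℕ} {F : Type*} [Fintype F]
  {A : ℕ → MKer D F} {V : ℕ → Fin D → Site D → MKer D F} {W : ℕ → Fin D → Site D → Fin D → Site D → MKer D F}
  {C Cv Cw εA εV εW δ : ℝ} {N k₀ : ℕ}

/-- **PAIRWISE EVENTUAL DEVIATIONS ⟹ CAUCHY BAND OF THE MOMENTS.**  `j`-uniform decay data and, for `j, j' ≥ k₀`, `Decays (A j − A j') εA δ`,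
`VertexFamily (V j − V j') N εV δ`, `VertexFamily₂ (W j − W j') N εW δ` ⟹ `|secondMoment (hessKer (A j)(V j)(W j)) μ ν − secondMoment (hessKer (A j')(V j')(W j')) μ ν|
≤ betaPrime510 D (lipConst D |F| δ C C Cv Cv Cw εA εV εW) (δ/4)`.  Proof: asym1's `geomRate_secondMoment_hessKer` at `θ = 1` on the shifted family with REFERENCE `(A j', V j', W j')`
in place of a limit. [folklore] -/
theorem eventualCauchyBand_secondMoment_hessKer (hA : ∀ j, Decays (A j) C δ) (hV : ∀ j, VertexFamily (V j) N Cv δ)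
    (hW : ∀ j, VertexFamily₂ (W j) N Cw δ)
    (hAdev : ∀ j j', k₀ ≤ j → k₀ ≤ j' → Decays (A j - A j') εA δ)
    (hVdev : ∀ j j', k₀ ≤ j → k₀ ≤ j' → VertexFamily (V j - V j') N εV δ)
    (hWdev : ∀ j j', k₀ ≤ j → k₀ ≤ j' → VertexFamily₂ (W j - W j') N εW δ) (hδ : 0 < δ) (hN : 1 ≤ N) (μ ν : Fin D) :
    EventualCauchyBand (fun j => secondMoment (hessKer (A j) (V j) (W j)) μ ν)
      (betaPrime510 D (lipConst D (Fintype.card F) δ C C Cv Cv Cw εA εV εW) (δ / 4)) k₀ := by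
  intro j j' hj hj'
  have h := geomRate_secondMoment_hessKer (θ := 1) (cA := εA) (cV := εV) (cW := εW)
    (A := fun i => A (k₀ + i)) (V := fun i => V (k₀ + i)) (W := fun i => W (k₀ + i)) (Ainf := A j') (Vinf := V j') (Winf := W j')
    (fun i => hA (k₀ + i)) (hA j') (fun i => by simpa using hAdev (k₀ + i) j' (Nat.le_add_right _ _) hj')
    (fun i => hV (k₀ + i)) (hV j') (fun i => by simpa using hVdev (k₀ + i) j' (Nat.le_add_right _ _) hj')
    (fun i => hW (k₀ + i)) (hW j') (fun i => by simpa using hWdev (k₀ + i) j' (Nat.le_add_right _ _) hj') hδ hN μ ν (j - k₀)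
  simp only [one_pow, mul_one] at h
  rwa [Nat.add_sub_cancel' hj] at h

end KernelBand

/-! ## §4 (MONO-K)₂: ONE sup-norm datum for all pairs beyond `k₀`, and its upgrade to weighted deviations by (I3) -/

section SupCauchy

variable {D : ℕ} {F : Type*} {A : ℕ → MKer D F} {C δ η₀ : ℝ} {k₀ : ℕ}

/-- SOCKET (MONO-K)₂, one-datum form: `SupBound (A j − A j') η₀` for all `j, j' ≥ k₀`.  For Loewner-ordered real-zone fibre matrices
`P_{j'} ≤ P_j` (`k₀ ≤ j ≤ j'`) this holds with `η₀` = any bound of `tr P_{k₀} −` (a `j`-uniform trace floor) — sibling `GAN24/MonotoneLoewner`; here a binder shape. [folklore] -/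
def SupCauchyBand (A : ℕ → MKer D F) (η₀ : ℝ) (k₀ : ℕ) : Prop := ∀ j j', k₀ ≤ j → k₀ ≤ j' → SupBound (A j - A j') η₀

/-- **(MONO-K)₂ + (I3) ⟹ PAIRWISE WEIGHTED DEVIATIONS, NO RATE** (p1's interpolation step `decays_half_of_decays_supBound`, King (4.38)):
`Decays (A j − A j') √(η₀·(C + C)) (δ/2)` for all `j, j' ≥ k₀`. [folklore] -/
theorem cauchyDecays_of_uniform_supCauchyBand (hA : ∀ j, Decays (A j) C δ) (hη : 0 ≤ η₀) (hsup : SupCauchyBand A η₀ k₀) :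
    ∀ j j', k₀ ≤ j → k₀ ≤ j' → Decays (A j - A j') (Real.sqrt (η₀ * (C + C))) (δ / 2) := fun j j' hj hj' =>
  decays_half_of_decays_supBound (decays_sub (hA j) (hA j')) hη (hsup j j' hj hj')

/-- NON-VACUITY: a constant family has the Cauchy sup band `0`. [folklore] -/
theorem supCauchyBand_const (A₀ : MKer D F) (k₀ : ℕ) : SupCauchyBand (fun _ => A₀) 0 k₀ := fun j j' _ _ x y a b => by simp

end SupCauchy

/-! ## §5 ASSEMBLY — rows × (MONO-K)₂ × (I3) × (DEV-SW) × dictionary ⟹ the carrier; no rate, no limit object, no limit identification -/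

section Assembly

variable {D : ℕ} {F : Type*} [Fintype F]
  {A : ℕ → MKer D F} {V : ℕ → Fin D → Site D → MKer D F} {W : ℕ → Fin D → Site D → Fin D → Site D → MKer D F}
  {C Cv Cw η₀ εV εW δ : ℝ} {N k₀ : ℕ} {μ ν : Fin D}

/-- THE CAUCHY-BAND CONSTANT: `betaPrime510 D (lipConst D cF (δ/2) C C Cv Cv Cw √(η₀·(C + C)) εV εW) ((δ/2)/4)`. [folklore] -/
noncomputable def cauchyConst (D : ℕ) (cF δ C Cv Cw η₀ εV εW : ℝ) : ℝ :=
  betaPrime510 D (lipConst D cF (δ / 2) C C Cv Cv Cw (Real.sqrt (η₀ * (C + C))) εV εW) (δ / 2 / 4)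

/-- **THE CAUCHY BAND OF THE MOMENTS FROM (MONO-K)₂ + (I3) + (DEV-SW)**: resolvent slot with `j`-uniform decay `(C, δ)` and pairwise sup band `η₀` from `k₀`;
jets with uniform data at rate `δ/2` and pairwise deviations `εV, εW` from `k₀` ⟹ `EventualCauchyBand (j ↦ secondMoment (hessKer (A j)(V j)(W j)) μ ν) (cauchyConst … η₀ εV εW) k₀`. [folklore] -/
theorem eventualCauchyBand_secondMoment_of_supCauchyBand (hA : ∀ j, Decays (A j) C δ) (hC : 0 ≤ C) (hsup : SupCauchyBand A η₀ k₀)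
    (hη : 0 ≤ η₀) (hV : ∀ j, VertexFamily (V j) N Cv (δ / 2)) (hW : ∀ j, VertexFamily₂ (W j) N Cw (δ / 2))
    (hVdev : ∀ j j', k₀ ≤ j → k₀ ≤ j' → VertexFamily (V j - V j') N εV (δ / 2))
    (hWdev : ∀ j j', k₀ ≤ j → k₀ ≤ j' → VertexFamily₂ (W j - W j') N εW (δ / 2)) (hδ : 0 < δ) (hN : 1 ≤ N) (μ ν : Fin D) :
    EventualCauchyBand (fun j => secondMoment (hessKer (A j) (V j) (W j)) μ ν) (cauchyConst D (Fintype.card F) δ C Cv Cw η₀ εV εW) k₀ := by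
  have hδ2 : δ / 2 ≤ δ := by linarith
  exact eventualCauchyBand_secondMoment_hessKer (fun j => decays_of_le_rate (hA j) hC hδ2) hV hW
    (cauchyDecays_of_uniform_supCauchyBand hA hη hsup) hVdev hWdev (by linarith) hN μ ν

variable {β : HBeta}

/-- **MEETING THEOREM (limit-free, end to end): ROWS × (MONO-K)₂ ⟹ THE (R15) CARRIER WITHOUT THE G-an2-4 RATE AND WITHOUT ROW D1's LIMIT VALUE.**
Hypotheses (named binders; nothing instantiated): `c : CapRows.Rows S.β0` (row CAP-k, beta-an5's carrier, literally); the dictionary `hβ` (row D1 ∕ the wall's reading of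
`β⁰_{j+1}`); (I3) `hA`; (MONO-K)₂ `hsup` with its datum `η₀` from `k₀ ≤ c.k₀`; (DEV-SW) `hV … hWdev`; (D4)-constant remainder `hrem`.  Conclusion:
`BetaAvgAFH (min m₀ (m − cauchyConst …) − r) 0 γ₀ β`. [folklore] -/
theorem betaAvgAFH_of_rows_supCauchyBand (S : B12Beta.OneLoopSplit β) (c : Rows S.β0)
    (hβ : ∀ j, S.β0 j = secondMoment (hessKer (A j) (V j) (W j)) μ ν)
    (hA : ∀ j, Decays (A j) C δ) (hC : 0 ≤ C) (hsup : SupCauchyBand A η₀ k₀) (hη : 0 ≤ η₀) (hk₀ : k₀ ≤ c.k₀)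
    (hV : ∀ j, VertexFamily (V j) N Cv (δ / 2)) (hW : ∀ j, VertexFamily₂ (W j) N Cw (δ / 2))
    (hVdev : ∀ j j', k₀ ≤ j → k₀ ≤ j' → VertexFamily (V j - V j') N εV (δ / 2))
    (hWdev : ∀ j j', k₀ ≤ j → k₀ ≤ j' → VertexFamily₂ (W j - W j') N εW (δ / 2))
    (hδ : 0 < δ) (hN : 1 ≤ N) {γ₀ r : ℝ} (hrem : RemainderConst S γ₀ r) :
    BetaAvgAFH (min ((c.m₀ : ℚ) : ℝ) ((c.m : ℚ) - cauchyConst D (Fintype.card F) δ C Cv Cw η₀ εV εW) - r) 0 γ₀ β := by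
  have hband := eventualCauchyBand_secondMoment_of_supCauchyBand hA hC hsup hη hV hW hVdev hWdev hδ hN μ ν
  have hband' : EventualCauchyBand S.β0 (cauchyConst D (Fintype.card F) δ C Cv Cw η₀ εV εW) k₀ := by
    intro j j' hj hj'
    rw [hβ j, hβ j']
    exact hband j j' hj hj'
  exact betaAvgAFH_of_rows_eventualCauchyBand S c hband' hk₀ hrem

end Assembly

/-! ## §6 Non-vacuity on the constant witness `β⁰ ≡ 1` (`CapRows.capRowsOne`) -/

open Beta.Assembly.Witness (splitOne)

/-- the constant sequence has the Cauchy band `0` from `0`. [folklore] -/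
theorem eventualCauchyBand_splitOne : EventualCauchyBand splitOne.β0 0 0 := fun j j' _ _ => by
  simp [Beta.Assembly.Witness.splitOne]

/-- the rows × Cauchy-band floor on the witness: `min 1 (1 − 0) ≤ β⁰ ≡ 1`. [folklore] -/
theorem floor_capRowsOne_cauchyBand : ∀ k, min ((capRowsOne.m₀ : ℚ) : ℝ) ((capRowsOne.m : ℚ) - 0) ≤ splitOne.β0 k :=
  floor_of_rows_eventualCauchyBand capRowsOne eventualCauchyBand_splitOne le_rfl

end Summit.QuantumFields.BalabanUV.Beta.GAN24.MonotoneCauchy
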